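import Literature.AnabelianGeometry.SemiGraphs.ThetaRayRefutationMaximalCompact
import Literature.AnabelianGeometry.SemiGraphs.ThetaRaySchedule
import HarnessLib

/-!
# `𝒢_θ(p, n)` refutes the ∀-countable readings of [SemiAnbd] Thm 3.7 (iii)/(iv) for EVERY schedule `n_k → ∞`

Mochizuki, *Semi-graphs of anabelioids*, Publ. RIMS **42** (2006) [MochizukiSemiAnbd2006], §3, Theorem 3.7
(iii)/(iv), author's manuscript pp. 40–41 [cite: MochizukiSemiAnbd2006, Thm 3.7(iii) pp.40-41]; the printed
proof concerns FINITE semi-graphs, where both are kernel theorems of the cell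
(`compactInVerticialAt_of_finiteGraph`, `maximalCompactIffVerticialAt_of_finiteGraph`, p431007).

PROOF-ONLY sequel (abc-iut-L3-t7 gen 6; 0 definitions, no named fact) of abc-iut-L3-d4's
`ThetaRayRefutation.lean` (`not_compactInVerticial`, F-1732; not imported — its inputs are) and abc-iut-w6-d120's
`ThetaRayRefutationMaximalCompact.lean` (`not_maximalCompactIffVerticial`, F-1750): their model theorems at the
countermodel `𝒢_θ(p, n)` of abc-iut-L3-d1 assume the schedule dominates the position, `k ≤ n k` (used only
through the coincidence binder (hcoin)).  With the (hcoin) producer of `ThetaRaySchedule.lean`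
(`FreeProPRankTwo.hcoin_concrete`, valid for every schedule with `n_k → ∞` — the level-`m` modulus of the
coincidence is constant along the ray) the SAME instantiation block gives the failures of Thm 3.7 (iii) (first
clause) and (iv) at `𝒢_θ(p, n)` for EVERY exponent sequence `n : ℕ → ℕ` tending to infinity (monotone or
not), i.e. exactly the family of the desk memo ("`n_k → ∞`"):

* `thetaRayFreeProP_not_compactInVerticialAt_of_tendsto (hn : Tendsto n atTop atTop)`,
* `thetaRayFreeProP_not_maximalCompactIffVerticialAt_of_tendsto (hn : Tendsto n atTop atTop)`,
* the `StrictMono` forms.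

HONEST FRAMING as in the two parent files: erratum-grade, about the ∀-countable TYPING only; nothing of the
IUT corpus is touched; no side taken on [IUTchIII] Cor. 3.12.
-/

noncomputable section

namespace Literature.AnabelianGeometry.SemiGraphs

namespace ProfiniteSemiGraph

open Filter Topology Multiplicative
open Literature.AnabelianGeometry.SemiGraphs.FreeProPRankTwo

variable (p : ℕ) [hp : Fact p.Prime] (n : ℕ → ℕ)

/-- **Thm 3.7 (iii) (first clause) and (iv) BOTH fail at `𝒢_θ(p, n)` for every schedule `n_k → ∞`.**
abc-iut-L3-d4's instantiation block (`ThetaRayRefutation.lean`) with (hcoin) := `FreeProPRankTwo.hcoin_concrete`.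
[cite: MochizukiSemiAnbd2006, Thm 3.7(iii) pp.40-41] -/
theorem thetaRayFreeProP_not_compactInVerticialAt_and_of_tendsto (hn : Tendsto n atTop atTop) :
    ¬ CompactInVerticialAt (thetaRayFreeProP p n) ∧ ¬ MaximalCompactIffVerticialAt (thetaRayFreeProP p n) := by
  classical
  haveI : NeZero p := ⟨hp.out.ne_zero⟩
  have h37 : (thetaRayFreeProP p n).Thm37Hypotheses :=
    -- = abc-iut-L3-d4's `thetaRayFreeProP_thm37Hypotheses'` (not imported: re-assembled from its inputs)
    thetaRayFreeProP_thm37Hypotheses p n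
      (thetaRayFreeProP_isGaloisCountable p (α p) (α_ofAdd_one p) (fun m => θHom p m)
        (fun m => (θ p m).bijective) n)
      (thetaRayFreeProP_isQuasiCoherent p (α p) (α_ofAdd_one p) (fun m => θHom p m)
        (fun m => (θ p m).bijective) n)
      (thetaRayFreeProP_isTotallyElevated_concrete p n)
      (thetaRayFreeProP_isTotallyAloof_concrete p n)
      (thetaRayFreeProP_isTotallyEstranged_concrete p n)
  have h36 : (thetaRayFreeProP p n).Prop36Hypotheses := h37.toProp36Hypotheses
  -- a base point sequence over `v_0`
  obtain ⟨P₀⟩ := thetaRay_nonempty_pointSeq_zero (G := Grp p) (E := Multiplicative ℤ_[p]) (up := α p)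
    (low := fun k => θα p (n k)) h36
  -- strict coherence (for abc-iut-L3-t6's level kernels)
  have hsc : (thetaRayFreeProP p n).IsStrictlyCoherent :=
    thetaRayFreeProP_isStrictlyCoherent p (α p) (α_ofAdd_one p) (fun m => θHom p m)
      (fun m => (θ p m).bijective) n
  -- (hcoin) for EVERY schedule tending to infinity (`ThetaRaySchedule.lean`)
  have hcoin : ∀ d : ℕ, ∃ N : ℕ, ∀ k, N ≤ k →
      ((fun k => θα p (n k)) (k + 1) (ofAdd (1 : ℤ_[p])))⁻¹ * α p (ofAdd 1) ∈ charOpenCore (Grp p) d :=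
    FreeProPRankTwo.hcoin_concrete p n hn
  -- hχA / hK / hsep exactly as in `ThetaRayRefutation.lean`
  have hχA : ∀ (m k : ℕ) (t : Multiplicative ℤ_[p]),
      χaMod p (n (m + 1) + 1) ((fun k => θα p (n k)) k t) = χaMod p (n (m + 1) + 1) (α p t) := by
    intro m k t
    change χaMod p _ (θ p (n k) (α p t)) = χaMod p _ (α p t)
    rw [χaMod_θ]
  have hK : ∀ m : ℕ, ∃ j₀ : ℕ, ∀ j, j₀ ≤ j → ∀ (w : ℕ)
      (P : ((thetaRayFreeProP p n).galoisLevelData h36).PointSeq h37.isCountable w) (x : Grp p),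
      P.gal j x = 1 → (abMod p (n (m + 1) + 1)).toMonoidHom x = 1 := by
    intro m
    obtain ⟨j₀, hj₀⟩ := (thetaRayFreeProP p n).exists_level_hK h36 hsc (p ^ (2 * (n (m + 1) + 1)))
    exact ⟨j₀, fun j hj w P x hx =>
      hj₀ j hj w P (abMod p (n (m + 1) + 1)).toMonoidHom (charOpenCore_le_ker_abMod p _) x hx⟩
  have hsep : ∀ (m : ℕ) (t₁ t₂ : Multiplicative ℤ_[p]),
      χaMod p (n (m + 1) + 1) ((fun k => θα p (n k)) (m + 1) t₁) = χaMod p (n (m + 1) + 1) (α p (ofAdd 1)) →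
      χaMod p (n (m + 1) + 1) (α p t₂) = χaMod p (n (m + 1) + 1) (α p (ofAdd 1)) →
      (abMod p (n (m + 1) + 1)).toMonoidHom ((fun k => θα p (n k)) (m + 1) t₁) ≠
        (abMod p (n (m + 1) + 1)).toMonoidHom (α p t₂) := by
    intro m t₁ t₂ h₁ h₂
    exact abMod_θ_α_ne_abMod_α_of_lt p (Nat.lt_succ_self _) t₁ t₂ h₁ h₂
  refine ⟨?_, ?_⟩
  · exact thetaRay_not_compactInVerticialAt_of_characters (G := Grp p) (E := Multiplicative ℤ_[p])
      (up := α p) (low := fun k => θα p (n k))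
      (A := fun m => Multiplicative (ZMod (p ^ (n (m + 1) + 1))))
      (V := fun m => Multiplicative (ZMod (p ^ (n (m + 1) + 1)) × ZMod (p ^ (n (m + 1) + 1))))
      h37 P₀ (ofAdd 1) hcoin (fun m => χaMod p (n (m + 1) + 1)) hχA
      (fun m => (abMod p (n (m + 1) + 1)).toMonoidHom) hK hsep
  · exact thetaRay_not_maximalCompactIffVerticialAt_of_characters (G := Grp p) (E := Multiplicative ℤ_[p])
      (up := α p) (low := fun k => θα p (n k))
      (A := fun m => Multiplicative (ZMod (p ^ (n (m + 1) + 1))))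
      (V := fun m => Multiplicative (ZMod (p ^ (n (m + 1) + 1)) × ZMod (p ^ (n (m + 1) + 1))))
      h37 P₀ (ofAdd 1) hcoin (fun m => χaMod p (n (m + 1) + 1)) hχA
      (fun m => (abMod p (n (m + 1) + 1)).toMonoidHom) hK hsep

/-- **Thm 3.7 (iii), first clause, FAILS at `𝒢_θ(p, n)` for every schedule `n_k → ∞`.**
[cite: MochizukiSemiAnbd2006, Thm 3.7(iii) pp.40-41] -/
theorem thetaRayFreeProP_not_compactInVerticialAt_of_tendsto (hn : Tendsto n atTop atTop) :
    ¬ CompactInVerticialAt (thetaRayFreeProP p n) :=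
  (thetaRayFreeProP_not_compactInVerticialAt_and_of_tendsto p n hn).1

/-- **Thm 3.7 (iv) FAILS at `𝒢_θ(p, n)` for every schedule `n_k → ∞`.** [cite: MochizukiSemiAnbd2006, Thm 3.7(iv) p.41] -/
theorem thetaRayFreeProP_not_maximalCompactIffVerticialAt_of_tendsto (hn : Tendsto n atTop atTop) :
    ¬ MaximalCompactIffVerticialAt (thetaRayFreeProP p n) :=
  (thetaRayFreeProP_not_compactInVerticialAt_and_of_tendsto p n hn).2

/-- The strictly increasing schedules (the desk memo's shape) are covered. [cite: MochizukiSemiAnbd2006, Thm 3.7(iii) pp.40-41] -/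
theorem thetaRayFreeProP_not_compactInVerticialAt_of_strictMono' (hn : StrictMono n) :
    ¬ CompactInVerticialAt (thetaRayFreeProP p n) ∧ ¬ MaximalCompactIffVerticialAt (thetaRayFreeProP p n) :=
  thetaRayFreeProP_not_compactInVerticialAt_and_of_tendsto p n (ThetaRaySchedule.tendsto_of_strictMono hn)

/-- The dominating schedules `k ≤ n k` of the parent files are covered (`Tendsto` by comparison with `id`).
[cite: MochizukiSemiAnbd2006, Thm 3.7(iii) pp.40-41] -/
theorem thetaRayFreeProP_not_compactInVerticialAt_and_of_le (hn : ∀ k, k ≤ n k) :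
    ¬ CompactInVerticialAt (thetaRayFreeProP p n) ∧ ¬ MaximalCompactIffVerticialAt (thetaRayFreeProP p n) :=
  thetaRayFreeProP_not_compactInVerticialAt_and_of_tendsto p n
    (tendsto_atTop_mono hn tendsto_id)

end ProfiniteSemiGraph

end Literature.AnabelianGeometry.SemiGraphs

end
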